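import Summits.AtomisticToContinuum.FouriersLaw.Theorems.OddSectorIrreversibilityConeScaleCorrectorStubHorizonCorrectorMemLp
import Summits.AtomisticToContinuum.FouriersLaw.Theorems.BondHeatUncertaintyExtensiveSnapshotIrreversibilityCorrectorCocycle

/-!
# `ConeScaleCorrector` (E1): the two split-ready decompositions D1 and D7 of the census, glued IN THE TREE

Support file for crux stmt-AtomisticToContinuum-14069 (`OddSectorIrreversibility.ConeScaleCorrector`, E1). The
crux-strategist's census (`Cruxes/ConeScaleCorrector/STRATEGY-CENSUS.md` §4, §6) hands the planner two typed
decompositions of E1 whose leaves are all genuine pieces, with the compositions kernel-checked only in Cruxes /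
evidence files (`SketchE1Children.lean`, `StrategistSketch.lean`) — not importable, so a `route edit --split
ConeScaleCorrector … --glue-by <thm>` had nothing in the tree to point at. This file lands both glues as theorems
concluding the route decl BY NAME, with the leaves stated INLINE (no `def`) over the Literature vocabulary
`OddSectorLocality.{gibbsWeight, currentForecast, forecastNormSq}`:

* **D1** `coneScaleCorrector_of_coneTransportBudget_of_postCrossingForecast` :
  C1 `ConeTransportBudget` (`∫ u_τ² dμ_T ≤ C·N·(1+τ)·Z` for all `τ ≥ 0` — verbatim the registered stub
  `stub_coneTransportBudget` of line GlueInnerCone) → C2 `PostCrossingForecast` (`∃ a > 0, C: u ∈ L²(μ_T)` and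
  `∫ (u − u_{aN})² dμ_T ≤ C·N²·Z` for every a.e.-limit corrector `u` — the ergodic child: the forecast of the transport
  still to come after ONE causal crossing is `O(N)` in norm) → `ConeScaleCorrector`; glue
  `∫u² ≤ 2∫u_{aN}² + 2∫(u − u_{aN})² ≤ 2(|C₁|(1+a) + |C₂|)·N²·Z`.
* **D7** `coneScaleCorrector_of_forecastArea_of_correlationTime` :
  (A1) `ForecastArea` (`∫₀^τ A_N ≤ C·N²·Z`, `A_N(t) = ‖P_tJ‖²_{μ_T}`, class-blind) → (A3) `ForecastCorrelationTime`
  (`‖u_τ‖² ≤ R·∫₀^τ A_N`, global ratio) → `ConeScaleCorrector`; glue = the all-horizon bound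
  `‖u_τ‖² ≤ (R⊔0)(C⊔0)N²Z` + Fatou along the a.e. limit (`Lp.eLpNorm_le_of_ae_tendsto`), using the landed fixed-`N`
  regularity `stub_horizonCorrectorMemLp` (p91238). Ported from `StrategistSketch.coneScaleCorrector_of_area_ratio`.

Both leaves of both splits are OPEN (supplier-less; census §4 D1/D7); nothing here asserts them. No definitions;
nothing here closes the crux.
-/

noncomputable section

open MeasureTheory Filter Topology Set
open scoped ENNReal NNReal
open Literature.MathematicalPhysics.KineticTheory.HeatConduction
open Literature.MathematicalPhysics.KineticTheory.OddSectorLocality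

namespace Summit.AtomisticToContinuum.FouriersLaw.Theorems.OddSectorIrreversibility

/-! ## Fatou in `L²` along a real parameter -/

section LTwo

variable {X : Type*} [MeasurableSpace X] {μ : Measure X}

/-- **Fatou step.** An a.e. limit (along `S → ∞` in `ℝ`) of functions `f S ∈ L²(μ)` with `√∫ (f S)² ≤ M` for
`S ≥ 0` is in `L²(μ)` with `∫ g² ≤ M²`. [folklore] -/
theorem memLp_and_integral_sq_le_of_ae_tendsto {f : ℝ → X → ℝ} {g : X → ℝ} {M : ℝ} (hM : 0 ≤ M)
    (hf : ∀ S, 0 ≤ S → MemLp (f S) 2 μ)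
    (hbound : ∀ S, 0 ≤ S → Real.sqrt (∫ x, f S x ^ 2 ∂μ) ≤ M)
    (hlim : ∀ᵐ x ∂μ, Tendsto (fun S => f S x) atTop (𝓝 (g x))) :
    MemLp g 2 μ ∧ ∫ x, g x ^ 2 ∂μ ≤ M ^ 2 := by
  have hf' : ∀ n : ℕ, AEStronglyMeasurable (f n) μ := fun n =>
    (hf n (Nat.cast_nonneg n)).aestronglyMeasurable
  have hlim' : ∀ᵐ x ∂μ, Tendsto (fun n : ℕ => f n x) atTop (𝓝 (g x)) := by
    filter_upwards [hlim] with x hx using hx.comp tendsto_natCast_atTop_atTop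
  have hbound' : ∀ᶠ n : ℕ in atTop, eLpNorm (f n) 2 μ ≤ ENNReal.ofReal M := by
    refine Eventually.of_forall fun n => ?_
    rw [ExtensiveSnapshotIrreversibility.ClausiusBudget.eLpNorm_two_eq_ofReal_sqrt_integral_sq (hf n (Nat.cast_nonneg n))]
    exact ENNReal.ofReal_le_ofReal (hbound n (Nat.cast_nonneg n))
  have hg_meas : AEStronglyMeasurable g μ := aestronglyMeasurable_of_tendsto_ae atTop hf' hlim'
  have hg_norm : eLpNorm g 2 μ ≤ ENNReal.ofReal M :=
    Lp.eLpNorm_le_of_ae_tendsto hbound' hf' hlim'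
  have hg_mem : MemLp g 2 μ := ⟨hg_meas, hg_norm.trans_lt ENNReal.ofReal_lt_top⟩
  refine ⟨hg_mem, ?_⟩
  have h1 : Real.sqrt (∫ x, g x ^ 2 ∂μ) ≤ M := by
    have h := hg_norm
    rw [ExtensiveSnapshotIrreversibility.ClausiusBudget.eLpNorm_two_eq_ofReal_sqrt_integral_sq hg_mem] at h
    exact (ENNReal.ofReal_le_ofReal_iff hM).1 h
  have h0 : 0 ≤ ∫ x, g x ^ 2 ∂μ := integral_nonneg fun _ => sq_nonneg _
  calc ∫ x, g x ^ 2 ∂μ = Real.sqrt (∫ x, g x ^ 2 ∂μ) ^ 2 := (Real.sq_sqrt h0).symm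
    _ ≤ M ^ 2 := pow_le_pow_left₀ (Real.sqrt_nonneg _) h1 2

/-- `∫ (f + g)² ≤ 2∫f² + 2∫g²` for `f, g ∈ L²(μ)`. [folklore] -/
theorem integral_add_sq_le_two_mul {f g : X → ℝ} (hf : MemLp f 2 μ) (hg : MemLp g 2 μ) :
    ∫ x, (f x + g x) ^ 2 ∂μ ≤ 2 * ∫ x, f x ^ 2 ∂μ + 2 * ∫ x, g x ^ 2 ∂μ := by
  have h1 : Integrable (fun x => f x ^ 2) μ := hf.integrable_sq
  have h2 : Integrable (fun x => g x ^ 2) μ := hg.integrable_sq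
  calc ∫ x, (f x + g x) ^ 2 ∂μ ≤ ∫ x, (2 * f x ^ 2 + 2 * g x ^ 2) ∂μ := by
        refine integral_mono_of_nonneg (Eventually.of_forall fun x => sq_nonneg _)
          ((h1.const_mul 2).add (h2.const_mul 2)) (Eventually.of_forall fun x => ?_)
        nlinarith [sq_nonneg (f x - g x)]
    _ = 2 * ∫ x, f x ^ 2 ∂μ + 2 * ∫ x, g x ^ 2 ∂μ := by
        rw [integral_add (h1.const_mul 2) (h2.const_mul 2), integral_const_mul, integral_const_mul]

end LTwo

/-! ## D1: `ConeTransportBudget → PostCrossingForecast → ConeScaleCorrector` -/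

/-- **D1 (census §4/§6).** C1 `ConeTransportBudget` (verbatim the registered stub `stub_coneTransportBudget`:
`∫ u_τ² dμ_T ≤ C·N·(1+τ)·Z`, all `N`, `τ ≥ 0`) and C2 `PostCrossingForecast` (`∃ a > 0, C`: every a.e.-limit
corrector `u` is in `L²(μ_T)` with `∫ (u − u_{aN})² dμ_T ≤ C·N²·Z`) imply the route decl `ConeScaleCorrector` BY NAME,
with `C_E1 = 2(|C₁|(1+a) + |C₂|)`: `∫u² ≤ 2∫u_{aN}² + 2∫(u−u_{aN})²` and `N(1 + aN) ≤ (1+a)N²`. [folklore] -/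
theorem coneScaleCorrector_of_coneTransportBudget_of_postCrossingForecast :
    (∀ ω₂ lam β γ : ℝ, 0 < ω₂ → 0 < lam → 0 < β → 0 < γ → ∀ T : ℝ, 0 < T → ∃ C : ℝ, ∀ (N : ℕ) (τ : ℝ),
      0 ≤ τ →
      ∫ x, (∫ t in Set.Ioc (0 : ℝ) τ,
          Literature.MathematicalPhysics.KineticTheory.OddSectorLocality.currentForecast ω₂ lam β γ T N t x) ^ 2
        ∂(Literature.MathematicalPhysics.KineticTheory.OddSectorLocality.gibbsWeight ω₂ lam β γ T N) ≤
      C * (N : ℝ) * (1 + τ) *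
        ∫ x, Real.exp (-((Literature.MathematicalPhysics.KineticTheory.HeatConduction.pinnedChain ω₂ lam β γ).hamiltonian N x) / T)
          ∂MeasureTheory.volume) →
    (∀ ω₂ lam β γ : ℝ, 0 < ω₂ → 0 < lam → 0 < β → 0 < γ → ∀ T : ℝ, 0 < T → ∃ a C : ℝ, 0 < a ∧
      ∀ (N : ℕ) (u : Literature.MathematicalPhysics.KineticTheory.HeatConduction.PhaseSpace N → ℝ),
      (∀ᵐ x ∂(Literature.MathematicalPhysics.KineticTheory.OddSectorLocality.gibbsWeight ω₂ lam β γ T N),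
        Filter.Tendsto (fun τ : ℝ => ∫ t in Set.Ioc (0 : ℝ) τ,
          Literature.MathematicalPhysics.KineticTheory.OddSectorLocality.currentForecast ω₂ lam β γ T N t x)
          Filter.atTop (nhds (u x))) →
      MeasureTheory.MemLp u 2 (Literature.MathematicalPhysics.KineticTheory.OddSectorLocality.gibbsWeight ω₂ lam β γ T N) ∧
      ∫ x, (u x - ∫ t in Set.Ioc (0 : ℝ) (a * (N : ℝ)),
          Literature.MathematicalPhysics.KineticTheory.OddSectorLocality.currentForecast ω₂ lam β γ T N t x) ^ 2
        ∂(Literature.MathematicalPhysics.KineticTheory.OddSectorLocality.gibbsWeight ω₂ lam β γ T N) ≤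
      C * (N : ℝ) ^ 2 *
        ∫ x, Real.exp (-((Literature.MathematicalPhysics.KineticTheory.HeatConduction.pinnedChain ω₂ lam β γ).hamiltonian N x) / T)
          ∂MeasureTheory.volume) →
    Summit.AtomisticToContinuum.FouriersLaw.Theses.OddSectorIrreversibility.ConeScaleCorrector := by
  intro hC1 hC2 ω₂ lam β γ hω hl hβ hγ T hT
  obtain ⟨C₁, hC₁⟩ := hC1 ω₂ lam β γ hω hl hβ hγ T hT
  obtain ⟨a, C₂, ha, hC₂⟩ := hC2 ω₂ lam β γ hω hl hβ hγ T hT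
  refine ⟨2 * (|C₁| * (1 + a) + |C₂|), fun N u => ?_⟩
  dsimp only
  intro hu
  obtain ⟨hmem, htail⟩ := hC₂ N u hu
  refine ⟨hmem, ?_⟩
  have haN : 0 ≤ a * (N : ℝ) := mul_nonneg ha.le (Nat.cast_nonneg N)
  have hhead := hC₁ N (a * N) haN
  have hmemS := stub_horizonCorrectorMemLp ω₂ lam β γ hω hl hβ hγ T hT N (a * N) haN
  set uS : PhaseSpace N → ℝ := fun x => ∫ t in Set.Ioc (0 : ℝ) (a * (N : ℝ)),
    currentForecast ω₂ lam β γ T N t x with huS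
  set z := ∫ x, Real.exp (-((pinnedChain ω₂ lam β γ).hamiltonian N x) / T)
    ∂(volume : Measure (PhaseSpace N)) with hz
  have hz0 : 0 ≤ z := integral_nonneg fun _ => (Real.exp_pos _).le
  have hN0 : (0 : ℝ) ≤ N := Nat.cast_nonneg N
  -- `u = u_S + (u - u_S)`
  have hsplit : ∫ x, (u x) ^ 2 ∂(gibbsWeight ω₂ lam β γ T N) ≤
      2 * ∫ x, (uS x) ^ 2 ∂(gibbsWeight ω₂ lam β γ T N) +
        2 * ∫ x, (u x - uS x) ^ 2 ∂(gibbsWeight ω₂ lam β γ T N) := by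
    have h := integral_add_sq_le_two_mul hmemS (hmem.sub hmemS)
    have e : (fun x => (uS x + (u x - uS x)) ^ 2) = fun x => (u x) ^ 2 := by
      funext x; ring
    simpa only [Pi.sub_apply, add_sub_cancel] using h
  change ∫ x, (u x) ^ 2 ∂(gibbsWeight ω₂ lam β γ T N) ≤ 2 * (|C₁| * (1 + a) + |C₂|) * (N : ℝ) ^ 2 * z
  have hhead' : ∫ x, (uS x) ^ 2 ∂(gibbsWeight ω₂ lam β γ T N) ≤ |C₁| * (1 + a) * (N : ℝ) ^ 2 * z := by
    have h1 : ∫ x, (uS x) ^ 2 ∂(gibbsWeight ω₂ lam β γ T N) ≤ C₁ * N * (1 + a * N) * z := hhead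
    have h2 : C₁ * N * (1 + a * N) * z ≤ |C₁| * (N * (1 + a * N)) * z := by
      have : C₁ * N * (1 + a * N) * z = C₁ * (N * (1 + a * N)) * z := by ring
      rw [this]
      apply mul_le_mul_of_nonneg_right _ hz0
      exact mul_le_mul_of_nonneg_right (le_abs_self _) (by positivity)
    have hNN : (N : ℝ) ≤ (N : ℝ) ^ 2 := by
      rcases Nat.eq_zero_or_pos N with h0 | hpos
      · simp [h0]
      · have h1' : (1 : ℝ) ≤ N := by exact_mod_cast hpos
        nlinarith
    have h3 : (N : ℝ) * (1 + a * N) ≤ (1 + a) * (N : ℝ) ^ 2 := by nlinarith [ha.le]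
    have h4 : |C₁| * (N * (1 + a * N)) * z ≤ |C₁| * ((1 + a) * (N : ℝ) ^ 2) * z := by
      apply mul_le_mul_of_nonneg_right _ hz0
      exact mul_le_mul_of_nonneg_left h3 (abs_nonneg _)
    calc _ ≤ _ := h1
      _ ≤ _ := h2
      _ ≤ _ := h4
      _ = |C₁| * (1 + a) * (N : ℝ) ^ 2 * z := by ring
  have htail' : ∫ x, (u x - uS x) ^ 2 ∂(gibbsWeight ω₂ lam β γ T N) ≤ |C₂| * (N : ℝ) ^ 2 * z := by
    have h1 : ∫ x, (u x - uS x) ^ 2 ∂(gibbsWeight ω₂ lam β γ T N) ≤ C₂ * (N : ℝ) ^ 2 * z := htail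
    refine h1.trans ?_
    apply mul_le_mul_of_nonneg_right _ hz0
    exact mul_le_mul_of_nonneg_right (le_abs_self _) (by positivity)
  calc ∫ x, (u x) ^ 2 ∂(gibbsWeight ω₂ lam β γ T N) ≤ _ := hsplit
    _ ≤ 2 * (|C₁| * (1 + a) * (N : ℝ) ^ 2 * z) + 2 * (|C₂| * (N : ℝ) ^ 2 * z) := by linarith
    _ = 2 * (|C₁| * (1 + a) + |C₂|) * (N : ℝ) ^ 2 * z := by ring

/-! ## D7: `ForecastArea → ForecastCorrelationTime → ConeScaleCorrector` -/

/-- **D7 (census §4/§6; the strategist's `coneScaleCorrector_of_area_ratio`, ported to the tree).** (A1) `ForecastArea`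
(`∫_{(0,τ]} A_N ≤ C·N²·Z` for all `τ ≥ 0`, `A_N = forecastNormSq`) and (A3) `ForecastCorrelationTime`
(`∫ u_τ² dμ_T ≤ R·∫_{(0,τ]} A_N` for all `τ ≥ 0`) imply the route decl `ConeScaleCorrector` BY NAME with
`C_E1 = (R ⊔ 0)(C ⊔ 0)`: the all-horizon bound `∫ u_τ² ≤ (R⊔0)(C⊔0)·N²·Z` passes to the a.e. limit by Fatou in
`L²` (`memLp_and_integral_sq_le_of_ae_tendsto`), the finite-horizon correctors being in `L²(μ_T)` by the landed
`stub_horizonCorrectorMemLp`. [folklore] -/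
theorem coneScaleCorrector_of_forecastArea_of_correlationTime :
    (∀ ω₂ lam β γ : ℝ, 0 < ω₂ → 0 < lam → 0 < β → 0 < γ → ∀ T : ℝ, 0 < T → ∃ C : ℝ,
      ∀ (N : ℕ) (τ : ℝ), 0 ≤ τ →
        ∫ t in Set.Ioc (0 : ℝ) τ, Literature.MathematicalPhysics.KineticTheory.OddSectorLocality.forecastNormSq ω₂ lam β γ T N t
          ≤ C * (N : ℝ) ^ 2 *
            ∫ x : Literature.MathematicalPhysics.KineticTheory.HeatConduction.PhaseSpace N,
              Real.exp (-((Literature.MathematicalPhysics.KineticTheory.HeatConduction.pinnedChain ω₂ lam β γ).hamiltonian N x) / T)) →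
    (∀ ω₂ lam β γ : ℝ, 0 < ω₂ → 0 < lam → 0 < β → 0 < γ → ∀ T : ℝ, 0 < T → ∃ R : ℝ,
      ∀ (N : ℕ) (τ : ℝ), 0 ≤ τ →
        ∫ x, (∫ t in Set.Ioc (0 : ℝ) τ, Literature.MathematicalPhysics.KineticTheory.OddSectorLocality.currentForecast ω₂ lam β γ T N t x) ^ 2
            ∂(Literature.MathematicalPhysics.KineticTheory.OddSectorLocality.gibbsWeight ω₂ lam β γ T N)
          ≤ R * ∫ t in Set.Ioc (0 : ℝ) τ, Literature.MathematicalPhysics.KineticTheory.OddSectorLocality.forecastNormSq ω₂ lam β γ T N t) →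
    Summit.AtomisticToContinuum.FouriersLaw.Theses.OddSectorIrreversibility.ConeScaleCorrector := by
  intro hA hR ω₂ lam β γ hω hl hβ hγ T hT
  obtain ⟨C, hC⟩ := hA ω₂ lam β γ hω hl hβ hγ T hT
  obtain ⟨R, hRR⟩ := hR ω₂ lam β γ hω hl hβ hγ T hT
  refine ⟨max R 0 * max C 0, fun N u => ?_⟩
  dsimp only
  intro hu
  set z := ∫ x, Real.exp (-((pinnedChain ω₂ lam β γ).hamiltonian N x) / T)
    ∂(volume : Measure (PhaseSpace N)) with hz
  change MemLp u 2 (gibbsWeight ω₂ lam β γ T N) ∧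
    ∫ x, (u x) ^ 2 ∂(gibbsWeight ω₂ lam β γ T N) ≤ max R 0 * max C 0 * (N : ℝ) ^ 2 * z
  have hZ0 : 0 ≤ z := integral_nonneg fun _ => (Real.exp_pos _).le
  have hN0 : (0 : ℝ) ≤ (N : ℝ) := Nat.cast_nonneg N
  have hmem : ∀ S : ℝ, 0 ≤ S → MemLp (fun x : PhaseSpace N => ∫ t in Set.Ioc (0 : ℝ) S,
      currentForecast ω₂ lam β γ T N t x) 2 (gibbsWeight ω₂ lam β γ T N) :=
    fun S hS => stub_horizonCorrectorMemLp ω₂ lam β γ hω hl hβ hγ T hT N S hS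
  -- the all-horizon bound
  have hall : ∀ S : ℝ, 0 ≤ S →
      ∫ x, (∫ t in Set.Ioc (0 : ℝ) S, currentForecast ω₂ lam β γ T N t x) ^ 2 ∂(gibbsWeight ω₂ lam β γ T N)
        ≤ (max R 0 * max C 0) * (N : ℝ) ^ 2 * z := by
    intro S hS
    have hA0 : 0 ≤ ∫ t in Set.Ioc (0 : ℝ) S, forecastNormSq ω₂ lam β γ T N t :=
      setIntegral_nonneg measurableSet_Ioc fun _ _ => integral_nonneg fun _ => sq_nonneg _
    have h2 : ∫ t in Set.Ioc (0 : ℝ) S, forecastNormSq ω₂ lam β γ T N t ≤ max C 0 * (N : ℝ) ^ 2 * z :=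
      (hC N S hS).trans (by gcongr; exact le_max_left _ _)
    calc ∫ x, (∫ t in Set.Ioc (0 : ℝ) S, currentForecast ω₂ lam β γ T N t x) ^ 2 ∂(gibbsWeight ω₂ lam β γ T N)
        ≤ R * ∫ t in Set.Ioc (0 : ℝ) S, forecastNormSq ω₂ lam β γ T N t := hRR N S hS
      _ ≤ max R 0 * ∫ t in Set.Ioc (0 : ℝ) S, forecastNormSq ω₂ lam β γ T N t :=
          mul_le_mul_of_nonneg_right (le_max_left _ _) hA0
      _ ≤ max R 0 * (max C 0 * (N : ℝ) ^ 2 * z) :=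
          mul_le_mul_of_nonneg_left h2 (le_max_right _ _)
      _ = (max R 0 * max C 0) * (N : ℝ) ^ 2 * z := by ring
  -- in `√`-form for Fatou
  set M : ℝ := Real.sqrt (max R 0 * max C 0) * (N : ℝ) * Real.sqrt z with hMdef
  have hM0 : 0 ≤ M := by positivity
  have hsq : M ^ 2 = (max R 0 * max C 0) * (N : ℝ) ^ 2 * z := by
    rw [hMdef, mul_pow, mul_pow, Real.sq_sqrt hZ0, Real.sq_sqrt (by positivity)]
  have hsqrt : ∀ S : ℝ, 0 ≤ S →
      Real.sqrt (∫ x, (∫ t in Set.Ioc (0 : ℝ) S, currentForecast ω₂ lam β γ T N t x) ^ 2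
        ∂(gibbsWeight ω₂ lam β γ T N)) ≤ M := by
    intro S hS
    rw [← Real.sqrt_sq hM0, hsq]
    exact Real.sqrt_le_sqrt (hall S hS)
  have h := memLp_and_integral_sq_le_of_ae_tendsto
    (f := fun S x => ∫ t in Set.Ioc (0 : ℝ) S, currentForecast ω₂ lam β γ T N t x) hM0 hmem hsqrt hu
  exact ⟨h.1, h.2.trans_eq hsq⟩

end Summit.AtomisticToContinuum.FouriersLaw.Theorems.OddSectorIrreversibility

end
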